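import Mathlib

/-!
# Spectral truncation of exponentially filtered sums (receipt for DEQ-A244)

Elementary inequalities behind the classical side of the note `DEQ-A244.md` (pub-qadeq, lane DEQ-1;
Xiantao Li, *Exponential Reduction of Mesh Dependence in Quantum Estimation of Parabolic PDE
Observables*, arXiv:2607.18113v1, explicit sine–Galerkin access model of its §4.4, eqs. (102)–(103)).
In modal coordinates of a Galerkin space on which the generator is `diag (λ_j)`, a linear parabolic
observable is the filtered sum `Q = ∑ g_j e^{-T λ_j} y_j`.

* `abs_sum_filter_gt_le` : the modes with `λ_j > Λ` contribute at most `e^{-TΛ} ‖g‖ ‖y‖`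
  (Cauchy–Schwarz), so keeping the `K(Λ)` modes with `λ_j ≤ Λ`, `Λ = T⁻¹ log(1/ε)`, gives additive
  error `ε ‖g‖ ‖y‖` — the mesh never enters;
* `sum_sq_mul_exp_le` : the second moment of Tang's `ℓ²`-sampling estimator,
  `‖y‖² ∑ g_j² e^{-2Tλ_j}`, is at most `e^{-2Tλ_min} ‖y‖² ‖g‖²` when `λ_min ≤ λ_j` for all `j`.

Instance-level adjudication of specific advantage claims; no claim about BQP vs BPP or the summit.
Mathlib only; no `sorry`.
-/

namespace Summit.QuantumAdvantage.Dequantization.HeatSemigroupSpectralTruncation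

open Finset Real

variable {ι : Type*} [Fintype ι]

/-- Cauchy–Schwarz in the form used below: `∑ |g i| |y i| ≤ √(∑ g i²) · √(∑ y i²)`. -/
theorem sum_abs_mul_abs_le_sqrt_mul_sqrt (g y : ι → ℝ) :
    ∑ i, |g i| * |y i| ≤ √(∑ i, g i ^ 2) * √(∑ i, y i ^ 2) := by
  have hcs : (∑ i, |g i| * |y i|) ^ 2 ≤ (∑ i, |g i| ^ 2) * (∑ i, |y i| ^ 2) :=
    Finset.sum_mul_sq_le_sq_mul_sq univ (fun i => |g i|) (fun i => |y i|)
  have hg : (∑ i, |g i| ^ 2) = ∑ i, g i ^ 2 := by simp [sq_abs]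
  have hy : (∑ i, |y i| ^ 2) = ∑ i, y i ^ 2 := by simp [sq_abs]
  rw [hg, hy] at hcs
  have hnn : 0 ≤ ∑ i, |g i| * |y i| :=
    Finset.sum_nonneg (fun i _ => mul_nonneg (abs_nonneg _) (abs_nonneg _))
  have hg0 : 0 ≤ ∑ i, g i ^ 2 := Finset.sum_nonneg (fun i _ => sq_nonneg _)
  calc ∑ i, |g i| * |y i| = abs (∑ i, |g i| * |y i|) := (abs_of_nonneg hnn).symm
    _ ≤ √((∑ i, g i ^ 2) * (∑ i, y i ^ 2)) := Real.abs_le_sqrt hcs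
    _ = √(∑ i, g i ^ 2) * √(∑ i, y i ^ 2) := Real.sqrt_mul hg0 _

/-- **Spectral truncation of a filtered bilinear sum.** For `T ≥ 0`, the modes with `lam i > Λ`
contribute at most `e^{-TΛ} · √(∑ g²) · √(∑ y²)` to `∑ g i · e^{-T lam i} · y i`. -/
theorem abs_sum_filter_gt_le [DecidableEq ι] (g y lam : ι → ℝ) {T Λ : ℝ} (hT : 0 ≤ T) :
    |∑ i ∈ univ.filter (fun i => Λ < lam i), g i * Real.exp (-(T * lam i)) * y i|
      ≤ Real.exp (-(T * Λ)) * (√(∑ i, g i ^ 2) * √(∑ i, y i ^ 2)) := by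
  set s := univ.filter (fun i => Λ < lam i) with hs
  have h1 : |∑ i ∈ s, g i * Real.exp (-(T * lam i)) * y i|
      ≤ ∑ i ∈ s, Real.exp (-(T * Λ)) * (|g i| * |y i|) := by
    refine (Finset.abs_sum_le_sum_abs _ _).trans (Finset.sum_le_sum fun i hi => ?_)
    have hli : Λ < lam i := (Finset.mem_filter.mp hi).2
    have hexp : Real.exp (-(T * lam i)) ≤ Real.exp (-(T * Λ)) := by
      apply Real.exp_le_exp.mpr
      have : T * Λ ≤ T * lam i := mul_le_mul_of_nonneg_left hli.le hT
      linarith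
    rw [abs_mul, abs_mul, abs_of_nonneg (Real.exp_pos _).le]
    have hgy : 0 ≤ |g i| * |y i| := mul_nonneg (abs_nonneg _) (abs_nonneg _)
    calc |g i| * Real.exp (-(T * lam i)) * |y i| = Real.exp (-(T * lam i)) * (|g i| * |y i|) := by ring
      _ ≤ Real.exp (-(T * Λ)) * (|g i| * |y i|) := mul_le_mul_of_nonneg_right hexp hgy
  have h2 : ∑ i ∈ s, Real.exp (-(T * Λ)) * (|g i| * |y i|)
      ≤ ∑ i, Real.exp (-(T * Λ)) * (|g i| * |y i|) :=
    Finset.sum_le_sum_of_subset_of_nonneg (Finset.filter_subset _ _)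
      (fun i _ _ => mul_nonneg (Real.exp_pos _).le (mul_nonneg (abs_nonneg _) (abs_nonneg _)))
  have h3 : ∑ i, Real.exp (-(T * Λ)) * (|g i| * |y i|)
      = Real.exp (-(T * Λ)) * ∑ i, |g i| * |y i| := by rw [Finset.mul_sum]
  calc |∑ i ∈ s, g i * Real.exp (-(T * lam i)) * y i|
      ≤ ∑ i ∈ s, Real.exp (-(T * Λ)) * (|g i| * |y i|) := h1
    _ ≤ ∑ i, Real.exp (-(T * Λ)) * (|g i| * |y i|) := h2
    _ = Real.exp (-(T * Λ)) * ∑ i, |g i| * |y i| := h3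
    _ ≤ Real.exp (-(T * Λ)) * (√(∑ i, g i ^ 2) * √(∑ i, y i ^ 2)) :=
        mul_le_mul_of_nonneg_left (sum_abs_mul_abs_le_sqrt_mul_sqrt g y) (Real.exp_pos _).le

/-- The same statement as an error bound for the truncated observable: full filtered sum minus the
sum over the kept modes `lam i ≤ Λ`. -/
theorem abs_sum_sub_sum_filter_le [DecidableEq ι] (g y lam : ι → ℝ) {T Λ : ℝ} (hT : 0 ≤ T) :
    |(∑ i, g i * Real.exp (-(T * lam i)) * y i)
        - ∑ i ∈ univ.filter (fun i => lam i ≤ Λ), g i * Real.exp (-(T * lam i)) * y i|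
      ≤ Real.exp (-(T * Λ)) * (√(∑ i, g i ^ 2) * √(∑ i, y i ^ 2)) := by
  have hsplit := Finset.sum_filter_add_sum_filter_not univ (fun i => lam i ≤ Λ)
    (fun i => g i * Real.exp (-(T * lam i)) * y i)
  have hnot : univ.filter (fun i => ¬ lam i ≤ Λ) = univ.filter (fun i => Λ < lam i) := by
    ext i; simp [not_le]
  rw [hnot] at hsplit
  have : (∑ i, g i * Real.exp (-(T * lam i)) * y i)
        - ∑ i ∈ univ.filter (fun i => lam i ≤ Λ), g i * Real.exp (-(T * lam i)) * y i
      = ∑ i ∈ univ.filter (fun i => Λ < lam i), g i * Real.exp (-(T * lam i)) * y i := by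
    rw [← hsplit]; ring
  rw [this]
  exact abs_sum_filter_gt_le g y lam hT

/-- **Second moment of the `ℓ²`-sampling estimator.** If `lamMin ≤ lam i` for every `i` and
`T ≥ 0`, then `∑ g i² e^{-2 T lam i} ≤ e^{-2 T lamMin} ∑ g i²`. -/
theorem sum_sq_mul_exp_le (g lam : ι → ℝ) {T lamMin : ℝ} (hT : 0 ≤ T)
    (hmin : ∀ i, lamMin ≤ lam i) :
    ∑ i, g i ^ 2 * Real.exp (-(2 * T * lam i)) ≤ Real.exp (-(2 * T * lamMin)) * ∑ i, g i ^ 2 := by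
  rw [Finset.mul_sum]
  refine Finset.sum_le_sum fun i _ => ?_
  have hexp : Real.exp (-(2 * T * lam i)) ≤ Real.exp (-(2 * T * lamMin)) := by
    apply Real.exp_le_exp.mpr
    have : 2 * T * lamMin ≤ 2 * T * lam i := mul_le_mul_of_nonneg_left (hmin i) (by linarith)
    linarith
  calc g i ^ 2 * Real.exp (-(2 * T * lam i)) ≤ g i ^ 2 * Real.exp (-(2 * T * lamMin)) :=
        mul_le_mul_of_nonneg_left hexp (sq_nonneg _)
    _ = Real.exp (-(2 * T * lamMin)) * g i ^ 2 := by ring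

end Summit.QuantumAdvantage.Dequantization.HeatSemigroupSpectralTruncation
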